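import Summits.ResolutionOfSingularities.ResolutionOfSingularities.Theorems.PurelyInseparableDim4AtlasCertCharts
import Summits.ResolutionOfSingularities.ResolutionOfSingularities.Theorems.PurelyInseparableDim4AtlasNodes
import HarnessLib

/-!
# Purely inseparable four-folds: the FIRST ESCAPING-CHILD CERTIFICATE of the v4 atlas chain — a marked resolution of
# `z^p + x₁^{2p} x₄ + x₂^{2p} x₃ + x₁ x₂^{p−1} x₃^p` (`p ≥ 3`) through a LINEAR ESCAPING child read on TWO charts (brick S3 (c) v4,
# tranche 1, brick A6; cell `res-dim4-pi`)

[OURS · counted 0] (D-0157 DOOR 2; host item stmt-ResolutionOfSingularities-16155, helper; crit-3 rider S-52-2 «one `MemberDataAT` instance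
on a real escaping child»). Nothing here proves resolution of singularities in dimension ≥ 4 / characteristic `p`. The v4 plan: root host
`V(z, x₁, x₂)` (`S₀ = {0,1}`, reading `r₀ = (⟨F,0,∅⟩, S₀, ∅, ∅)`), ONE entry `e₀ = (0, 0, {0,2})` — ESCAPING (`S₀ ⊄ {0,2}`): its child
`{x₃ = 0} × ℙ¹ ⊆ E` is read on chart `x₁` (main reading, state `F₀`, centre `{0,2}`) and on chart `x₂` (extra reading, state `F₁`, centre
`{1,2}`, deferring `x₁ = 0`); no leaves anywhere; after the child's blow-up every chart is dead. `BlockA` at the three readings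
(A6-computations / A6-charts), accessibility, the root cover `x₁ = x₂ = 0`, and the entry point `exists_isMarkedResolution_atlas_root` (A5-root)
give the marked resolution — the first run of the whole chain A1–A5 on an escaping child.

* **`exists_isMarkedResolution_acert`**. AI-produced formalisation, weaker than expert review.
bears_on: LADDER-RESOLUTION:D157-DOOR2 (res-dim4-pi · S3 (c) v4 A6 certificate).
-/

set_option linter.dupNamespace false -- D-0017: single-problem summit path `Summit.<S>.<S>.…` by design

noncomputable section

open MvPolynomial Finset CategoryTheory AlgebraicGeometry Opposite TopologicalSpace
open AlgebraicGeometry.Scheme.IdealSheafData (ofIdealTop vanishingIdeal)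

namespace Summit.ResolutionOfSingularities.ResolutionOfSingularities.Theorems.PIDim4

open Literature.AlgebraicGeometry.Resolution
open Literature.AlgebraicGeometry.Resolution.Hauser2010
open Literature.AlgebraicGeometry.Resolution.AffinePointBlowup (P A γ coord Wtop ξ)

namespace Equimultiple

section ACertInstance

variable {K : Type} [Field K] {p : ℕ} [hp : Fact p.Prime] [CharP K p]

/-- **THE FIRST ESCAPING-CHILD CERTIFICATE (v4 A6).** See the module docstring. [cite: BierstoneGrigorievMilmanWlodarczyk2011,
Def. 3.1.3; §4 Step 2b] [cite: Hauser2010, §F (equiconstant points)] -/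
theorem exists_isMarkedResolution_acert [IsAlgClosed K] [DecidableEq K] (hp3 : 3 ≤ p) :
    ∃ (X' : Scheme.{0}) (ρ : X' ⟶ P 4 K) (M' : MarkedIdeal X'),
      IsMarkedResolution (⟨hypSheaf p (X 0 ^ (2 * p) * X 3 + X 1 ^ (2 * p) * X 2 + X 0 * X 1 ^ (p - 1) * X 2 ^ p :
        MvPolynomial (Fin 4) K), [], p⟩ : MarkedIdeal (P 4 K)) ρ M' := by
  classical
  set F : MvPolynomial (Fin 4) K := X 0 ^ (2 * p) * X 3 + X 1 ^ (2 * p) * X 2 + X 0 * X 1 ^ (p - 1) * X 2 ^ p with hFdef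
  -- centres, the entry, the tables
  set S₀ : Finset (Fin 4) := {0, 1} with hS₀
  set S₁ : Finset (Fin 4) := {0, 2} with hS₁
  have h10 : S₁ ≠ S₀ := by rw [hS₀, hS₁]; decide
  have hT₂ : insert (1 : Fin 4) (S₁.erase 0) = ({1, 2} : Finset (Fin 4)) := by rw [hS₁]; decide
  have h20 : insert (1 : Fin 4) (S₁.erase 0) ≠ S₀ := by rw [hT₂, hS₀]; decide
  have hdiff : S₀ \ S₁ = ({1} : Finset (Fin 4)) := by rw [hS₀, hS₁]; decide
  set e₀ : Fin 4 × (Fin 4 → K) × Finset (Fin 4) := ((0 : Fin 4), (0 : Fin 4 → K), S₁) with he₀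
  let plan : AReading K → Finset (Fin 4 × (Fin 4 → K) × Finset (Fin 4)) := fun r => if r.2.1 = S₀ then {e₀} else ∅
  let leaves : AReading K → Finset (Fin 4 × (Fin 4 → K)) := fun _ => ∅
  -- the states and the readings
  set s₀ : State K := ⟨F, 0, ∅⟩ with hs₀
  have hs₀F : s₀.F = X 0 ^ (2 * p) * X 3 + X 1 ^ (2 * p) * X 2 + X 0 * X 1 ^ (p - 1) * X 2 ^ p := rfl
  set r₀ : AReading K := (s₀, S₀, (∅ : Finset (Fin 4 × K)), (∅ : Finset (Fin 4))) with hr₀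
  set r₁ : AReading K := mainReading p r₀ e₀ with hr₁
  set r₂ : AReading K := extraReading p r₀ e₀ 1 with hr₂
  have hr₁T : r₁.2.1 = S₁ := rfl
  have hr₂T : r₂.2.1 = insert (1 : Fin 4) (S₁.erase 0) := rfl
  have hr₁F : r₁.1.F = C 1 * (X 0 ^ p * X 1 ^ 0 * X 2 ^ 0 * X 3 ^ 1) + C 1 * (X 0 ^ p * X 1 ^ (2 * p) * X 2 ^ 1 * X 3 ^ 0) +
      C 1 * (X 0 ^ 0 * X 1 ^ (p - 1) * X 2 ^ p * X 3 ^ 0) := step_S0_acert s₀ hs₀F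
  have hr₂F : r₂.1.F = C 1 * (X 0 ^ (2 * p) * X 1 ^ p * X 2 ^ 0 * X 3 ^ 1) + C 1 * (X 0 ^ 0 * X 1 ^ p * X 2 ^ 1 * X 3 ^ 0) +
      C 1 * (X 0 ^ 1 * X 1 ^ 0 * X 2 ^ p * X 3 ^ 0) := escState_S1_acert s₀ hs₀F
  have hplan₀ : plan r₀ = {e₀} := if_pos rfl
  have hplan₁ : plan r₁ = ∅ := if_neg h10
  have hplan₂ : plan r₂ = ∅ := if_neg h20
  -- the edges
  have hE₀ : ∀ q', AEdge p plan q' r₀ ↔ q' = r₁ ∨ q' = r₂ := by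
    intro q'
    constructor
    · rintro ⟨e, he, h | ⟨l, hl, h⟩⟩
      · rw [hplan₀, Finset.mem_singleton] at he; rw [h, he]; exact Or.inl rfl
      · rw [hplan₀, Finset.mem_singleton] at he
        rw [he] at hl h
        change l ∈ S₀ \ S₁ at hl
        rw [hdiff, Finset.mem_singleton] at hl
        rw [h, hl]; exact Or.inr rfl
    · rintro (rfl | rfl)
      · exact ⟨e₀, by rw [hplan₀]; exact Finset.mem_singleton_self _, Or.inl rfl⟩
      · refine ⟨e₀, by rw [hplan₀]; exact Finset.mem_singleton_self _, Or.inr ⟨1, ?_, rfl⟩⟩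
        change (1 : Fin 4) ∈ S₀ \ S₁
        rw [hdiff]; exact Finset.mem_singleton_self _
  have hE₁ : ∀ q', ¬ AEdge p plan q' r₁ := by
    rintro q' ⟨e, he, -⟩; rw [hplan₁] at he; exact absurd he (Finset.notMem_empty e)
  have hE₂ : ∀ q', ¬ AEdge p plan q' r₂ := by
    rintro q' ⟨e, he, -⟩; rw [hplan₂] at he; exact absurd he (Finset.notMem_empty e)
  have hreach₀ : ∀ q, Relation.ReflTransGen (fun a e : AReading K => AEdge p plan e a) r₀ q → q = r₀ ∨ q = r₁ ∨ q = r₂ := by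
    intro q hq
    induction hq with
    | refl => exact Or.inl rfl
    | tail _ h ih =>
      rcases ih with rfl | rfl | rfl
      · exact Or.inr ((hE₀ _).mp h)
      · exact absurd h (hE₁ _)
      · exact absurd h (hE₂ _)
  have hacc₁ : Acc (fun q' q : AReading K => AEdge p plan q' q) r₁ := Acc.intro _ fun q' h => absurd h (hE₁ q')
  have hacc₂ : Acc (fun q' q : AReading K => AEdge p plan q' q) r₂ := Acc.intro _ fun q' h => absurd h (hE₂ q')
  have hacc₀ : Acc (fun q' q : AReading K => AEdge p plan q' q) r₀ :=
    Acc.intro _ fun q' h => by rcases (hE₀ q').mp h with rfl | rfl; exacts [hacc₁, hacc₂]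
  -- helpers
  have hemp : ∀ {α : Type} (x : α) (P : Prop), x ∈ (∅ : Finset α) → P := fun x P hx => absurd hx (Finset.notMem_empty x)
  have hesc : IsEscaping S₀ e₀ := by change ¬ S₀ ⊆ S₁; rw [hS₀, hS₁]; decide
  -- the three blocks
  have hblock₁ : BlockA p plan leaves r₁ := by
    refine ⟨fun e he => hemp e _ (by rw [hplan₁] at he; exact he), fun e he => hemp e _ (by rw [hplan₁] at he; exact he),
      fun l hl => hemp l _ hl, fun j' b' hj' hb' _ _ heq => ?_⟩
    exfalso
    rw [hr₁T, hS₁] at hj' heq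
    rcases Finset.mem_insert.mp hj' with rfl | hj'
    · exact not_isEquimultiplePoint_T0_acert r₁.1 hr₁F heq
    · rw [Finset.mem_singleton] at hj'; subst hj'
      exact not_isEquimultiplePoint_T2_acert hp3 r₁.1 hr₁F heq
  have hblock₂ : BlockA p plan leaves r₂ := by
    refine ⟨fun e he => hemp e _ (by rw [hplan₂] at he; exact he), fun e he => hemp e _ (by rw [hplan₂] at he; exact he),
      fun l hl => hemp l _ hl, fun j' b' hj' hb' _ _ heq => ?_⟩
    exfalso
    rw [hr₂T, hT₂] at hj' heq
    rcases Finset.mem_insert.mp hj' with rfl | hj'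
    · exact not_isEquimultiplePoint_R1_acert hp3 r₂.1 hr₂F heq
    · rw [Finset.mem_singleton] at hj'; subst hj'
      exact not_isEquimultiplePoint_R2_acert r₂.1 hr₂F heq
  have hblock₀ : BlockA p plan leaves r₀ := by
    refine ⟨fun e he => ?_, fun e he e' he' hne => ?_, fun l hl => hemp l _ hl, fun j' b' hj' hb' hnorm _ heq => ?_⟩
    · -- (P1) for the entry
      rw [hplan₀, Finset.mem_singleton] at he
      subst he
      refine ⟨by change (0 : Fin 4) ∈ S₀; rw [hS₀]; decide, rfl, by change (0 : Fin 4) ∈ S₁; rw [hS₁]; decide,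
        fun i hi => hemp i _ hi, fun iv hiv => hemp iv _ hiv, isEquimultiplePoint_S0_zero_acert hp3 s₀ hs₀F, ?_, fun _ => ⟨fun i _ => rfl, ?_⟩⟩
      · change IsPermissibleCentre p S₁ (CentreBlowup.step p S₀ 0 (0 : Fin 4 → K) s₀).F
        rw [step_S0_acert s₀ hs₀F, hS₁]
        exact isPermissibleCentre_T_F0_acert
      · intro l hl
        change l ∈ S₀ \ S₁ at hl
        rw [hdiff, Finset.mem_singleton] at hl
        subst hl
        change IsPermissibleCentre p (insert (1 : Fin 4) (S₁.erase 0)) (escState p S₀ 1 (0 : Fin 4 → K) s₀).F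
        rw [escState_S1_acert s₀ hs₀F, hT₂]
        exact isPermissibleCentre_R_F1_acert
    · -- (P2): one entry only
      rw [hplan₀, Finset.mem_singleton] at he he'
      exact absurd (he.trans he'.symm) hne
    · -- (P5): everything is on the child
      change j' ∈ S₀ at hj'
      rw [hS₀] at hj'
      rcases Finset.mem_insert.mp hj' with rfl | hj'
      · have hb2 := eq_zero_of_isEquimultiplePoint_S0_acert hp3 s₀ hs₀F heq hb'
        refine Or.inl ⟨e₀, by rw [hplan₀]; exact Finset.mem_singleton_self _, rfl, fun i hi => ?_⟩
        change i ∈ S₁ at hi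
        rw [hS₁] at hi
        rcases Finset.mem_insert.mp hi with rfl | hi
        · exact hb'
        · rw [Finset.mem_singleton] at hi; subst hi; exact hb2
      · rw [Finset.mem_singleton] at hj'; subst hj'
        have hb0 : b' 0 = 0 := hnorm 0 (by change (0 : Fin 4) ∈ S₀; rw [hS₀]; decide) (by decide)
        have hb2 := eq_zero_of_isEquimultiplePoint_S1_acert hp3 s₀ hs₀F heq hb0 hb'
        refine Or.inr (Or.inl ⟨e₀, by rw [hplan₀]; exact Finset.mem_singleton_self _, hesc, by change (0 : Fin 4) ≠ 1; decide,
          by change (1 : Fin 4) ∉ S₁; rw [hS₁]; decide, fun i hi hiS hi0 => ?_, fun i hi hiS => ?_⟩)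
        · exfalso
          change i ∈ S₁ at hi; change i ∈ S₀ at hiS
          rw [hS₁] at hi; rw [hS₀] at hiS
          rcases Finset.mem_insert.mp hi with rfl | hi
          · exact hi0 rfl
          · rw [Finset.mem_singleton] at hi; subst hi; exact absurd hiS (by decide)
        · change i ∈ S₁ at hi; change i ∉ S₀ at hiS
          rw [hS₁] at hi; rw [hS₀] at hiS
          rcases Finset.mem_insert.mp hi with rfl | hi
          · exact absurd (by decide) hiS
          · rw [Finset.mem_singleton] at hi; subst hi; exact hb2
  -- the root
  have hF' : deletePthPowers p (PointBlowup.translate (0 : Fin 4 → K) F) = F := by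
    rw [PointBlowup.translate_zero]
    exact Literature.Barriers.ResolutionOfSingularities.HauserPerlega.deletePthPowers_eq_self (isClean_acert hp.out.two_le)
  refine exists_isMarkedResolution_atlas_root (p := p) F acert_ne_zero (isClean_acert hp.out.two_le) plan leaves 0 S₀ s₀
    (by rw [hF']) isPermissibleCentre_S_acert (fun q hq => ?_) hacc₀ fun z hz hord i hi => ?_
  · rcases hreach₀ q hq with rfl | rfl | rfl
    exacts [hblock₀, hblock₁, hblock₂]
  · obtain ⟨a, b, hzab⟩ := exists_eq_vanishingIdeal_cons_of_isClosed hz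
    have hord' := (natCast_le_idealOrder_hypSheaf_iff (p := p) F hzab p).mp hord
    rw [natCast_le_ordZero_translate_hyp_iff] at hord'
    obtain ⟨-, H⟩ := hord'
    obtain ⟨hb0, hb1⟩ := roots_acert b H
    change i ∈ S₀ at hi
    rw [hS₀] at hi
    rcases Finset.mem_insert.mp hi with rfl | hi
    · exact (X_succ_sub_C_mem_asIdeal_iff 0 _ a b hzab).mpr hb0
    · rw [Finset.mem_singleton] at hi; subst hi
      exact (X_succ_sub_C_mem_asIdeal_iff 1 _ a b hzab).mpr hb1

end ACertInstance

end Equimultiple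

end Summit.ResolutionOfSingularities.ResolutionOfSingularities.Theorems.PIDim4

end
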